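import Mathlib
import HarnessLib
import Summits.Langlands.Langlands.Theses.OrdinaryPrimeTransport
import Literature.NumberTheory.Automorphic.ACCSolubleDescent

/-!
# Birth skeleton (BC3) for crux stmt-Langlands-17210
`Summit.Langlands.Langlands.Theses.OrdinaryPrimeTransport.SummandsPotentiallyAutomorphic` — line `birth`

Route `route-Langlands-OrdinaryPrimeTransport` (rev 13; `closes (hPA : SummandsPotentiallyAutomorphic)
(hOrd : OrdinaryPrimeExists) (hRS : RankinSelbergPoleCountR) (hT : PrimeRankTransport)
(hOff : IrreducibleOffPrimeRankSector) (hE : ReciprocityUpToIrreducibility)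
(hU : IrreducibleAvatarsConjugate) : Langlands`; this crux is `hPA`, rank 2, "the heart").

THE CRUX. `K` totally real or CM, `p` an odd prime, `π` cuspidal L-algebraic of regular infinity type on
`GL_p(𝔸_K)`, `(ℓ₀, ι₀)` such that SOME a.e.-Satake–Frobenius-compatible avatar `ρ₁ : Γ_K → GL_p(ℚ̄_ℓ₀)`
is crystalline-ordinary (`IsCrystallineOrdinaryAt`: full flag, unramified · `ε^b` diagonal, `b` strictly
decreasing) at every `v ∣ ℓ₀`. Then for every compatible avatar `ρ₀` at `ι₀`, every `0 < k < p`, every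
IRREDUCIBLE framed `σ` of rank `k` and framed `τ` of rank `p - k` with
`charpoly ρ₀(g) = charpoly σ(g) · charpoly τ(g)` on `Γ_K` (exact summand of `ρ₀^ss`), `σ` is STRONGLY
potentially automorphic: a finite Galois CM `F'/K` with `σ|_{F'}` irreducible such that for every
intermediate `E` with `F'/E` soluble some cuspidal `Π_E` on `GL_k(𝔸_E)` is Satake–Frobenius compatible
with `σ|_E` a.e.

THE CUT (four stubs, following the seams of the vendored engines; grounder notes of 2026-08-16 on the item:
`Qian2022.potentialAutomorphy_ordinary` (Qian, Invent. Math. 231 (2023) Thm 1.4 = arXiv:2104.09761),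
`ACC2023.solubleDescent_isAutomorphic` (ACC+ Ann. of Math. 197 (2023) Prop 6.5.13 (2) = arXiv:1812.09999),
`AHTW2026.deRham_hodgeTateRegular` (arXiv:2607.11763 Thm 1.2.1) are all NAMED FACTS in the tree, and the
interface between Qian's / ACC's rendering of automorphy (`Qian2022.IsAutomorphic ι r`: `r ≅ r_{ℓ,ι}(Π)`
for a REGULAR ALGEBRAIC cuspidal `Π`, HLTT normalisation `rec(Π_v ⊗ |det|^{(1-n)/2})`) and the route's
(`Summit.Langlands.SatakeFrobCompatibleAt`: Buzzard–Gee's untwisted `m = 1` normalisation for ANY cuspidal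
`P`) is "NOT part of" those facts):

* `stub_summand_inherits` (L; provable now modulo named facts) — SUMMAND INHERITANCE at an ordinary prime:
  in the crux's situation the irreducible exact summand `σ` is (a) unramified at all but finitely many
  places, (b) crystalline-ordinary at every `v ∣ ℓ₀`, (c) de Rham at every `v ∣ ℓ₀` for the PINNED
  Fontaine datum `fontainePstAdicCompletion v ℓ₀ hv` (the datum of `Summit.Langlands.IsGeometricFramed`).
  Paper proof: Satake uniqueness (`hasSatakeParamAt_unique`) ⇒ `ρ₀`, `ρ₁` have equal Frobenius
  polynomials a.e. ⇒ Chebotarev + continuity + Brauer–Nesbitt ⇒ `ρ₀^ss ≅ ρ₁^ss`; `σ` irreducible with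
  `charpoly ρ₀ = charpoly σ · charpoly τ` ⇒ `σ` is a Jordan–Hölder constituent of `ρ₁` (and of `ρ₀`);
  (a) constituents of an a.e.-unramified representation are a.e. unramified; (b) `σ|_{Γ_{K_v}}` is a
  subquotient of `ρ₁|_{Γ_{K_v}}`, and a subquotient of a representation with a full `Γ_v`-stable flag of
  graded characters `ψ_i ε^{b_i}` (`b` strictly decreasing) carries the induced sub-flag, whose exponents
  are a subsequence, still strictly decreasing (`isCrystallineOrdinaryAt_conj_iff` for the frame);
  (c) `ρ₀` (semisimplified) is de Rham above `ℓ₀` by AHTW Thm 1.2.1 (`AHTW2026.isDeRhamFramed_of_isCompatible`,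
  CM `K`; totally real `K` through a CM quadratic base change) and subquotients of de Rham representations
  are de Rham. It does NOT give the crux (no automorphy anywhere) nor the summit.
* `stub_potentiallyAutomorphic_ordinary` (XL, THE OPEN CORE, said openly) — ORDINARY POTENTIAL AUTOMORPHY
  WITH FIELD CONTROL, in the engines' own vocabulary: `K` totally real or CM, `k ≥ 1`, `σ : Γ_K → GL_k(ℚ̄_ℓ₀)`
  irreducible, a.e. unramified, crystalline-ordinary and de Rham (pinned datum) at every `v ∣ ℓ₀` ⇒ there
  is a finite Galois CM `F'/K` with `σ|_{Γ_{F'}}` irreducible and `Qian2022.IsAutomorphic ι₀ (σ|_{Γ_{F'}})`.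
  This is Qian Thm 1.4 MINUS its residual hypotheses (iii)–(iv) (`σ̄` absolutely irreducible and
  decomposed generic, `σ̄(Γ_{K(ζ_ℓ₀)})` enormous, a scalar `σ̄(g)`), PLUS a totally real base (CM quadratic
  base change first) and the two control clauses (`F'/K` Galois — Moret-Bailly with Galois descent as in
  HSBT/BLGGT — and `σ|_{F'}` irreducible — linear disjointness from the monodromy-component field, Qian's
  clause `IsField (Kav ⊗[K] K')`). KNOWN exactly in Qian's sector; OPEN at small / badly placed ordinary
  primes where a summand is residually small or reducible (the route's why-it-might-fail; Hui 2023 Thm 1.2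
  controls residual irreducibility of type-A summands at almost all `λ` only); `k = 1` is class field
  theory (de Rham characters are automorphic). TRUE under the summit (Fontaine–Mazur–Langlands for `σ`,
  then cyclic base change to a CM quadratic `F'` keeping `σ` irreducible). It does NOT give the crux on
  its own (needs (b),(c) of stub 1, the descent of stub 3 and the renormalisation of stub 4) nor the summit.
* `stub_solubleDescent_intermediate` (M/L; `k ≥ 2` = the named fact `ACC2023.solubleDescent_isAutomorphic`
  plus glue, `k = 1` = class field theory) — SOLUBLE DESCENT TO EVERY INTERMEDIATE FIELD: `σ : Γ_K → GL_k`,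
  `F'/K` finite Galois CM, `σ|_{F'}` irreducible and Qian-automorphic ⇒ for every intermediate `K ⊆ E ⊆ F'`
  with `Gal(F'/E)` soluble, `σ|_E` is Qian-automorphic. Glue the prover supplies: an intermediate field of
  a CM Galois extension is totally real or CM (complex conjugation is central in `Aut(F')`), `F'/E` is
  Galois (`IsGalois.tower_top_of_isGalois`), `(σ|_E)|_{F'} ≃ σ|_{F'}` up to a change of frame
  (`nonempty_equiv_restrictField_restrictField`, `SorensenPatchingHypotheses`) and conjugation-invariance
  of irreducibility / `IsAutomorphic` (`HarrisLanTaylorThorne2016.isCompatible_conj_iff`). This is where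
  "descent to each `E` must fix the twist" (why-it-might-fail) lives: ACC+ select the twist through `r_ι`.
* `stub_satakeCompatible_of_isAutomorphic` (M; provable now modulo `hasSatakeParamAt_cofinite`) —
  RENORMALISATION: a Qian-automorphic `r : Γ_E → GL_k(ℚ̄_ℓ)` (`k ≥ 1`, any number field `E`) is
  Satake–Frobenius compatible, in the summit's untwisted normalisation, with SOME cuspidal `P` on
  `GL_k(𝔸_E)` at all but finitely many places: `P := Π ⊗ |det|^{(1-k)/2}` (tree: `AlgebraicityTwist`,
  `exists_cuspidalAutomorphicRepData_map_mulChar_detTwist`; Satake parameter `q_w^{(k-1)/2} α`, and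
  `arithFrobPolyOfSatake ι q 1 (q^{(k-1)/2} α) = arithFrobPolyOfSatake ι q k α`), the exceptional set being
  the places above `ℓ` and above the finitely many rational primes over which `E` or `Π` ramifies
  (`AutomorphicRepData.isUnramifiedAbove_cofinite`).
* `SummandsPotentiallyAutomorphic_of : stub 1 → stub 2 → stub 3 → stub 4 → SummandsPotentiallyAutomorphic`
  — kernel-checked, no `sorry`, all four hypotheses load-bearing: stub 1 feeds (a),(b),(c) of `σ` to
  stub 2, which yields `F'`; for an intermediate soluble-index `E`, stub 3 descends Qian-automorphy to
  `σ|_E` and stub 4 converts it into the crux's Satake–Frobenius clause over `E`.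

Shape (for `ledger skeleton check` / `#h21_check_skeleton`): stubs `theorem stub_<name> : <signature> := by
sorry` (closed statements over existing declarations only); `_Goal.stub_<name> : Prop := type_of%
@stub_<name>` names each statement; the composition takes `(h₁ : _Goal.stub_summand_inherits) …
(h₄ : _Goal.stub_satakeCompatible_of_isAutomorphic)` and concludes the route decl BY (fully qualified)
NAME; the final `example` feeds the four stubs to it. Sorries: exactly the four stubs. Imports: the route
module (so the verbatim sub-clauses elaborate to the route's terms), `ACCSolubleDescent` (which brings
`Qian2022PotentialAutomorphy`: the vocabulary `Qian2022.IsAutomorphic` and the two engines by name),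
Mathlib, HarnessLib.

Disproof used: none exists — `ledger crux ls stmt-Langlands-17210` lists no workfiles (no `Disproof.lean`,
no `Negative/` lemma, no dead line, no crux ideas) at registration time (2026-08-17). Item evidence: the
refuter's route review `OPT-review.md` (2026-08-16: "precisely typed … k = 1 summands are de Rham
characters (CFT ✓); vacuous for irreducible ρ₀ by Brauer–Nesbitt ✓; the open heart (Qian on hypothetical
summands, residual hypotheses untyped)") — the cut names that heart as stub 2 and keeps `k = 1` inside
stubs 2–4 as their class-field-theoretic sub-case. `ledger negatives --problem Langlands` (3 entries:
SplitPrimeInductionDeinduction — exceptional-set mismatch; OrdinaryPrimeTransportRankinSelbergPoleCount —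
the rank-`0` junk `π₀` on `GL_0`; K3KugaSatakeDescentSerreTypeAnchor) — nothing of the shape of these
stubs; every stub here carries `0 < k` (and stub 1 the crux's own `0 < k < p`), so the `GL_0` witness of
the second entry has no purchase.
-/

set_option linter.dupNamespace false

noncomputable section

namespace Summit.Langlands.Langlands.Cruxes.SummandsPotentiallyAutomorphic.Birth

open Summit.Langlands.Langlands.Theses.OrdinaryPrimeTransport
open Filter
open scoped NumberField

/-! ## 1. The four stubs -/

/-- **STUB 1 — summand inheritance at an ordinary prime** (genuine, provable now modulo the named facts
`hasSatakeParamAt_unique`, `AHTW2026.deRham_hodgeTateRegular` at the pinned datum, cyclic base change for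
totally real `K`): `K` totally real or CM, `π` cuspidal L-algebraic of regular infinity type on
`GL_p(𝔸_K)`, `(ℓ₀, ι₀)` with SOME a.e.-compatible avatar `ρ₁` crystalline-ordinary at every `v ∣ ℓ₀`; then
for every a.e.-compatible avatar `ρ₀` at `ι₀`, every `0 < k < p` and every IRREDUCIBLE exact framed
summand `σ` of rank `k` (`charpoly ρ₀ = charpoly σ · charpoly τ` on `Γ_K`): (a) `σ` is unramified at all
but finitely many places, (b) `σ` is crystalline-ordinary at every `v ∣ ℓ₀`, (c) `σ` is de Rham at every
`v ∣ ℓ₀` for the pinned Fontaine datum `fontainePstAdicCompletion v ℓ₀ hv`. Why true: Satake uniqueness +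
Chebotarev + Brauer–Nesbitt give `ρ₀^ss ≅ ρ₁^ss`, so `σ` is a Jordan–Hölder constituent of `ρ₁` and of `ρ₀`;
constituents inherit a.e.-unramifiedness; `σ|_{Γ_{K_v}}` is a subquotient of the ordinary `ρ₁|_{Γ_{K_v}}`
and inherits the induced full flag with a strictly decreasing SUBSEQUENCE of the cyclotomic exponents and
unramified diagonal characters; de Rham-ness of the avatars above `ℓ₀` is AHTW Thm 1.2.1 (CM `K`; totally
real `K` via a CM quadratic base change) and passes to subquotients.
[cite: AHTW2026, Thm. 1.2.1] [cite: DeligneSerreASENS1974, Lemme 3.2] -/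
theorem stub_summand_inherits :
    ∀ (K : Type) [Field K] [NumberField K], (NumberField.IsTotallyReal K ∨ NumberField.IsCMField K) →
      ∀ (p : ℕ) (hcpt : Literature.NumberTheory.Automorphic.isCompact_glFiniteIntegralLevel p K)
        (π : Literature.NumberTheory.Automorphic.CuspidalAutomorphicRepData p K hcpt), π.1.IsLAlgebraic →
        (∃ T : Literature.NumberTheory.Automorphic.InfinityType K p, π.1.HasInfinityType T ∧ T.IsRegular) →
      ∀ (ℓ₀ : ℕ) [Fact ℓ₀.Prime] (ι₀ : PadicAlgCl ℓ₀ ≃+* ℂ),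
        (∃ ρ₁ : Literature.NumberTheory.GaloisRepresentations.FramedGaloisRep K (PadicAlgCl ℓ₀) p,
          (∀ᶠ v : IsDedekindDomain.HeightOneSpectrum (𝓞 K) in cofinite,
            Summit.Langlands.SatakeFrobCompatibleAt ι₀ π.1 ρ₁ v) ∧
          ∀ v : IsDedekindDomain.HeightOneSpectrum (𝓞 K), ((ℓ₀ : ℕ) : 𝓞 K) ∈ v.asIdeal →
            ρ₁.IsCrystallineOrdinaryAt ℓ₀ v) →
      ∀ (ρ₀ : Literature.NumberTheory.GaloisRepresentations.FramedGaloisRep K (PadicAlgCl ℓ₀) p),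
        (∀ᶠ v : IsDedekindDomain.HeightOneSpectrum (𝓞 K) in cofinite,
          Summit.Langlands.SatakeFrobCompatibleAt ι₀ π.1 ρ₀ v) →
      ∀ (k : ℕ), 0 < k → k < p →
      ∀ (σ : Literature.NumberTheory.GaloisRepresentations.FramedGaloisRep K (PadicAlgCl ℓ₀) k)
        (τ : Literature.NumberTheory.GaloisRepresentations.FramedGaloisRep K (PadicAlgCl ℓ₀) (p - k)),
        σ.toGaloisRep.IsIrreducible →
        (∀ g : Field.absoluteGaloisGroup K, ρ₀.charpoly g = σ.charpoly g * τ.charpoly g) →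
      (∀ᶠ v : IsDedekindDomain.HeightOneSpectrum (𝓞 K) in cofinite, σ.IsUnramifiedAt v) ∧
      (∀ v : IsDedekindDomain.HeightOneSpectrum (𝓞 K), ((ℓ₀ : ℕ) : 𝓞 K) ∈ v.asIdeal →
          σ.IsCrystallineOrdinaryAt ℓ₀ v) ∧
      (∀ (v : IsDedekindDomain.HeightOneSpectrum (𝓞 K)) (hv : ((ℓ₀ : ℕ) : 𝓞 K) ∈ v.asIdeal),
          (Literature.NumberTheory.PAdicHodge.fontainePstAdicCompletion v ℓ₀ hv).IsDeRhamFramed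
            (σ.toLocal v)) := by
  sorry

/-- **STUB 2 — ordinary potential automorphy with control of the field (THE OPEN CORE)**, in the
vocabulary of the vendored engines: for `K` totally real or CM, `k ≥ 1`, `ℓ₀`, `ι₀ : ℚ̄_ℓ₀ ≃ ℂ` and an
IRREDUCIBLE `σ : Γ_K → GL_k(ℚ̄_ℓ₀)` which is unramified almost everywhere and, at every `v ∣ ℓ₀`,
crystalline-ordinary (`IsCrystallineOrdinaryAt`: full flag, unramified · `ε^{b_i}` diagonal, `b` strictly
decreasing — regular Hodge–Tate weights) and de Rham for the pinned Fontaine datum, there is a finite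
Galois CM extension `F'/K` with `σ|_{Γ_{F'}}` irreducible and `σ|_{Γ_{F'}} ≅ r_{ℓ₀,ι₀}(Π)` for a regular
algebraic cuspidal `Π` of `GL_k(𝔸_{F'})` (`Qian2022.IsAutomorphic ι₀ (σ.restrictField F')`). KNOWN in Qian's
sector (Thm 1.4 = tree `Qian2022.potentialAutomorphy_ordinary`: CM base, `k ≥ 2`, residual hypotheses
`σ̄` absolutely irreducible + decomposed generic + enormous on `Γ_{K(ζ_ℓ₀)}` + a scalar element; the
ordinarity there is `IsOrdinaryRegularAt v (𝓐 K v)`, reached from `IsCrystallineOrdinaryAt` through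
`ε ∘ Art = N⁻¹` on units for the canonical Artin datum), with the field control supplied by Qian's
avoidance clause `IsField (Kav ⊗[K] K')` (irreducibility of `σ|_{F'}`: avoid the monodromy-component
field) and by Moret-Bailly with Galois descent (Galois over a totally real `K` after a CM quadratic base
change); `k = 1`: de Rham characters are automorphic (class field theory, Weil). OPEN — the route's
why-it-might-fail — when the summand is residually small / reducible / non-generic at the given ordinary
prime (Hui 2023 Thm 1.2 gives residual irreducibility of type-A summands at almost all `λ` only). TRUE
under the summit: Fontaine–Mazur–Langlands for the geometric regular `σ`, then cyclic base change to a CM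
quadratic `F'` on which `σ` stays irreducible. Gives neither the crux (no descent, no renormalisation, and
its hypotheses are stub 1's conclusions) nor the summit.
[cite: Qian2022, Thm. 1.4] [cite: AllenCalegariCaraianiGeeEtAl2023, Thm. 6.1.2] -/
theorem stub_potentiallyAutomorphic_ordinary :
    ∀ (K : Type) [Field K] [NumberField K], (NumberField.IsTotallyReal K ∨ NumberField.IsCMField K) →
      ∀ (k : ℕ), 0 < k → ∀ (ℓ₀ : ℕ) [Fact ℓ₀.Prime] (ι₀ : PadicAlgCl ℓ₀ ≃+* ℂ)
        (σ : Literature.NumberTheory.GaloisRepresentations.FramedGaloisRep K (PadicAlgCl ℓ₀) k),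
        σ.toGaloisRep.IsIrreducible →
        (∀ᶠ v : IsDedekindDomain.HeightOneSpectrum (𝓞 K) in cofinite, σ.IsUnramifiedAt v) →
        (∀ v : IsDedekindDomain.HeightOneSpectrum (𝓞 K), ((ℓ₀ : ℕ) : 𝓞 K) ∈ v.asIdeal →
          σ.IsCrystallineOrdinaryAt ℓ₀ v) →
        (∀ (v : IsDedekindDomain.HeightOneSpectrum (𝓞 K)) (hv : ((ℓ₀ : ℕ) : 𝓞 K) ∈ v.asIdeal),
          (Literature.NumberTheory.PAdicHodge.fontainePstAdicCompletion v ℓ₀ hv).IsDeRhamFramed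
            (σ.toLocal v)) →
        ∃ (F' : Type) (_ : Field F') (_ : NumberField F') (_ : Algebra K F') (_ : IsGalois K F'),
          NumberField.IsCMField F' ∧ (σ.restrictField F').toGaloisRep.IsIrreducible ∧
            Literature.NumberTheory.Automorphic.Qian2022.IsAutomorphic ι₀ (σ.restrictField F') := by
  sorry

/-- **STUB 3 — soluble descent of automorphy to every intermediate field** (genuine; `k ≥ 2` is the
named fact `ACC2023.solubleDescent_isAutomorphic` = ACC+ Prop 6.5.13 (2) plus glue, `k = 1` is class
field theory): for any number field `K`, `k ≥ 1`, `σ : Γ_K → GL_k(ℚ̄_ℓ₀)` and a finite Galois CM extension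
`F'/K` such that `σ|_{Γ_{F'}}` is irreducible and Qian-automorphic, and every intermediate field
`K ⊆ E ⊆ F'` with `Gal(F'/E)` soluble, `σ|_{Γ_E}` is Qian-automorphic. Glue: an intermediate field of a
CM Galois extension is totally real or CM (complex conjugation is central in `Aut(F')`, so it stabilises
`E` and commutes with every embedding of `E`); `F'/E` is Galois; `(σ|_E)|_{F'} ≃ σ|_{F'}` up to a change of
frame (`nonempty_equiv_restrictField_restrictField`), under which irreducibility and `IsAutomorphic` are
invariant (`HarrisLanTaylorThorne2016.isCompatible_conj_iff`). Printed proof (ACC+): induction to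
`F'/E` cyclic of prime degree, strong multiplicity one, Arthur–Clozel cyclic descent, and the twist
selected through `r_ι` — "descent to each `E` must fix the twist" is exactly this step.
[cite: AllenCalegariCaraianiGeeEtAl2023, Prop. 6.5.13 (2)] [cite: ArthurClozelAMS120, Ch. 3 Thm. 4.2 and 5.1] -/
theorem stub_solubleDescent_intermediate :
    ∀ (K : Type) [Field K] [NumberField K] (k : ℕ), 0 < k →
      ∀ (ℓ₀ : ℕ) [Fact ℓ₀.Prime] (ι₀ : PadicAlgCl ℓ₀ ≃+* ℂ)
        (σ : Literature.NumberTheory.GaloisRepresentations.FramedGaloisRep K (PadicAlgCl ℓ₀) k)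
        (F' : Type) [Field F'] [NumberField F'] [Algebra K F'] [IsGalois K F'],
        NumberField.IsCMField F' → (σ.restrictField F').toGaloisRep.IsIrreducible →
        Literature.NumberTheory.Automorphic.Qian2022.IsAutomorphic ι₀ (σ.restrictField F') →
      ∀ (E : Type) [Field E] [NumberField E] [Algebra K E] [Algebra E F'] [IsScalarTower K E F'],
        IsSolvable (F' ≃ₐ[E] F') →
          Literature.NumberTheory.Automorphic.Qian2022.IsAutomorphic ι₀ (σ.restrictField E) := by
  sorry

/-- **STUB 4 — renormalisation: Qian-automorphic ⇒ Satake–Frobenius compatible with some cuspidal `P`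
a.e.** (genuine, provable now modulo `hasSatakeParamAt_cofinite`): for any number field `E`, `k ≥ 1`,
`ℓ`, `ι` and `r : Γ_E → GL_k(ℚ̄_ℓ)` with `r ≅ r_{ℓ,ι}(Π)` for a regular algebraic cuspidal `Π`
(`Qian2022.IsAutomorphic ι r`: compatibility `charpoly(Frob_w) = ∏ (X - ι⁻¹((q_w^{(k-1)/2} α_j)⁻¹))` at
every `w` over a rational prime `q ≠ ℓ` above which `E` and `Π` are unramified), there is a cuspidal `P`
on `GL_k(𝔸_E)` — namely `P := Π ⊗ |det|^{(1-k)/2}`, whose Satake parameter at `w` is `q_w^{(k-1)/2} α`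
— such that `r` is Satake–Frobenius compatible with `P` in the summit's untwisted normalisation
(`arithFrobPolyOfSatake ι q_w 1 ·`) at all but finitely many `w` (those above `ℓ` and above the finitely
many rational primes over which `E` or `Π` ramifies). Tree handles: `AlgebraicityTwist`
(`exists_cuspidalAutomorphicRepData_map_mulChar_detTwist`, twists of cusp forms and their parameters),
`arithFrobPolyOfSatake`, `AutomorphicRepData.isUnramifiedAbove_cofinite`.
[cite: BuzzardGeeLMS2014, §2.1 and Conj. 3.2.1] [cite: HarrisLanTaylorThorneRMS2016, Thm. A] -/
theorem stub_satakeCompatible_of_isAutomorphic :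
    ∀ (E : Type) [Field E] [NumberField E] (k : ℕ), 0 < k →
      ∀ (ℓ : ℕ) [Fact ℓ.Prime] (ι : PadicAlgCl ℓ ≃+* ℂ)
        (r : Literature.NumberTheory.GaloisRepresentations.FramedGaloisRep E (PadicAlgCl ℓ) k),
        Literature.NumberTheory.Automorphic.Qian2022.IsAutomorphic ι r →
        ∃ (hE : Literature.NumberTheory.Automorphic.isCompact_glFiniteIntegralLevel k E)
          (P : Literature.NumberTheory.Automorphic.CuspidalAutomorphicRepData k E hE),
          ∀ᶠ w : IsDedekindDomain.HeightOneSpectrum (𝓞 E) in cofinite,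
            Summit.Langlands.SatakeFrobCompatibleAt ι P.1 r w := by
  sorry

/-! ## 2. The stub statements as named propositions (the composition's hypotheses, by name)

`_Goal` is internal on purpose: audits listing the file's declarations by short name find the `stub_*`
THEOREMS, while `#h21_check_skeleton` accepts the hypotheses of `SummandsPotentiallyAutomorphic_of` by the
stub names they carry. Each `_Goal.stub_x` is `type_of% @stub_x` — no text duplicated, no `sorry`
inherited. -/

namespace _Goal

/-- The statement of `stub_summand_inherits`, as a named `Prop` (literally its type). [folklore] -/
def stub_summand_inherits : Prop :=
  type_of% @Summit.Langlands.Langlands.Cruxes.SummandsPotentiallyAutomorphic.Birth.stub_summand_inherits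

/-- The statement of `stub_potentiallyAutomorphic_ordinary`, as a named `Prop`. [folklore] -/
def stub_potentiallyAutomorphic_ordinary : Prop :=
  type_of% @Summit.Langlands.Langlands.Cruxes.SummandsPotentiallyAutomorphic.Birth.stub_potentiallyAutomorphic_ordinary

/-- The statement of `stub_solubleDescent_intermediate`, as a named `Prop`. [folklore] -/
def stub_solubleDescent_intermediate : Prop :=
  type_of% @Summit.Langlands.Langlands.Cruxes.SummandsPotentiallyAutomorphic.Birth.stub_solubleDescent_intermediate

/-- The statement of `stub_satakeCompatible_of_isAutomorphic`, as a named `Prop`. [folklore] -/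
def stub_satakeCompatible_of_isAutomorphic : Prop :=
  type_of% @Summit.Langlands.Langlands.Cruxes.SummandsPotentiallyAutomorphic.Birth.stub_satakeCompatible_of_isAutomorphic

end _Goal

/-! ## 3. The composition (kernel-checked, no `sorry`): inheritance → ordinary PA → descent → renormalisation -/

/-- **`SummandsPotentiallyAutomorphic` from the four stubs.** In the crux's situation STUB 1 makes the
irreducible exact summand `σ` a.e. unramified, crystalline-ordinary and de Rham above `ℓ₀`; STUB 2 gives a
finite Galois CM `F'/K` with `σ|_{F'}` irreducible and Qian-automorphic; for an intermediate `E` with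
`Gal(F'/E)` soluble STUB 3 descends Qian-automorphy to `σ|_E`, and STUB 4 turns it into the crux's clause:
a cuspidal `P` on `GL_k(𝔸_E)` Satake–Frobenius compatible with `σ|_E` almost everywhere. The hypotheses
are, by name, the statements of the four stubs; the conclusion is the route decl
`Summit.Langlands.Langlands.Theses.OrdinaryPrimeTransport.SummandsPotentiallyAutomorphic`. [folklore] -/
theorem SummandsPotentiallyAutomorphic_of (h₁ : _Goal.stub_summand_inherits)
    (h₂ : _Goal.stub_potentiallyAutomorphic_ordinary) (h₃ : _Goal.stub_solubleDescent_intermediate)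
    (h₄ : _Goal.stub_satakeCompatible_of_isAutomorphic) :
    Summit.Langlands.Langlands.Theses.OrdinaryPrimeTransport.SummandsPotentiallyAutomorphic := by
  unfold _Goal.stub_summand_inherits at h₁
  unfold _Goal.stub_potentiallyAutomorphic_ordinary at h₂
  unfold _Goal.stub_solubleDescent_intermediate at h₃
  unfold _Goal.stub_satakeCompatible_of_isAutomorphic at h₄
  intro K _ _ hK p hp h3 hcpt π hL hreg ℓ₀ _ ι₀ hord ρ₀ hρ₀ k hk hkp σ τ hσ hchar
  -- STUB 1: the summand inherits a.e.-unramifiedness, ordinarity and de Rham-ness above `ℓ₀`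
  obtain ⟨hunr, hordσ, hdRσ⟩ := h₁ K hK p hcpt π hL hreg ℓ₀ ι₀ hord ρ₀ hρ₀ k hk hkp σ τ hσ hchar
  -- STUB 2: potential automorphy over a finite Galois CM `F'/K` keeping `σ` irreducible
  obtain ⟨F', _, _, _, _, hCM, hirr', haut'⟩ := h₂ K hK k hk ℓ₀ ι₀ σ hσ hunr hordσ hdRσ
  refine ⟨F', inferInstance, inferInstance, inferInstance, inferInstance, hCM, hirr', ?_⟩
  intro E _ _ _ _ _ hsolv
  -- STUB 3: soluble descent to the intermediate field `E`
  have hautE := h₃ K k hk ℓ₀ ι₀ σ F' hCM hirr' haut' E hsolv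
  -- STUB 4: renormalise to the summit's Satake–Frobenius clause
  exact h₄ E k hk ℓ₀ ι₀ (σ.restrictField E) hautE

/-- By-name sanity check (an `example`, not a declaration of the file): the four stubs feed the
composition as they stand. -/
example : Summit.Langlands.Langlands.Theses.OrdinaryPrimeTransport.SummandsPotentiallyAutomorphic :=
  SummandsPotentiallyAutomorphic_of stub_summand_inherits stub_potentiallyAutomorphic_ordinary
    stub_solubleDescent_intermediate stub_satakeCompatible_of_isAutomorphic

end Summit.Langlands.Langlands.Cruxes.SummandsPotentiallyAutomorphic.Birth

end
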